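import Summits.HodgeConjecture.HodgeConjecture.Theses.TropicalKugaSatakeCayley

/-!
# Line `formal-rational` — crux `EffectiveCayleyNonRealizability` (K1) of route `TropicalKugaSatakeCayley`

Crux item `stmt-HodgeConjecture-18569`; crux decl
`Summit.HodgeConjecture.HodgeConjecture.Theses.TropicalKugaSatakeCayley.EffectiveCayleyNonRealizability`.

STRATEGIST'S ALTERNATIVE LINE (lens: transfer to a rigid category). The live line (`Lines/birth.lean`)
cuts K1 as ALL-OR-NOTHING ∧ NOT-ALL-REALISABLE: its open core `stub_notAllRealizable` asks for an
obstruction functional separating ONE generic Hodge class from the span of the open-effectively-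
realisable ones — a DUAL object nobody knows how to write down (Zharkov's linear ansatz fails; the
prior programme's census C1/C2/F4 never produced one). This line is the PRIMAL cut: it replaces the
arbitrary `t`-families of real cycles of K1 by ONE finite piece of `ℚ`-linear data — an AFFINE-LINEAR
FORMAL CHAIN over `ℚ[t₁,…,t₅]` (`Chain (MvPolynomial (Fin 5) ℚ) 8 2`, `IsAffineLinear`; Kontsevich's
"cycles varying rationally over the parameters", Zharkov p. 3) that is a cycle FORMALLY (its framed
boundary cancels in the polynomial ring, i.e. with `t`-independent translation labels) — and asks for
the class statement on that object only:

* `stub_rationalFormalization` (L): open-effective realisability of `M` on `U` ⟹ some affine-linear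
  formal chain over `ℚ` evaluates, at every `t` of a non-empty open `V ⊆ U`, to an effective cycle of
  `ℝ⁸ / B_t ℤ⁸` with period class `M`. Mechanism: Baire (a `t* ∈ U` with `ℚ`-independent coordinates),
  the incidence equations of `Z_{t*}` are a rational linear system `A x = N t` whose solvability locus
  is a rational subspace containing `t*`, hence `ℝ⁵`; a RATIONAL affine section `x(t) = x₀ + S t`
  (`x₀` a rational point of `ker A` close to `x_{Z} - S t*`) passes `ε`-close to `Z_{t*}`; coarsened
  incidences keep `IsCycle`, effectivity is open, the class is locally constant along the section
  (homology rationality, MZ Prop. 4.3) — prior programme Thm. C ("formal cycles = Minkowski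
  interpolation") with the rational-section refinement.
* `stub_identityPrinciple` (M): for an affine-linear formal chain, "cycle with period class `M` at every
  `t` of an open set" upgrades to the FORMAL cycle condition `IsCycle ksMatrixPoly` over `ℚ[t]` (the
  incidence pattern at a generic `t` is the formal one: a non-identity `f' - f = B_t k` holds only on a
  proper algebraic subset, countably many `k`), `M` is RATIONAL (read it off at one rational `t ∈ V`),
  and `V` contains a rational parameter.
* `stub_formalCoreRigidity` (XL, the transferred core C⁺): a formal rational affine-linear CYCLE of the
  Kuga–Satake family that is effective with constant period class `Mq` on a non-empty open subset of the
  cone has `Mq ∈ ℚ • 1`. WHY EASIER than K1: (i) the object is finite and defined over `ℚ`; bounded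
  instances (`size ≤ n`, bounded heights) are DECIDABLE (LP feasibility of Kontsevich–Zharkov's
  equations (1),(2) per combinatorial type; exact enumeration), so rungs are theorems and a counterexample
  search is a finite job; (ii) it exposes the MINKOWSKI structure `𝒵(t) = Σ tᵢ 𝒵⁽ⁱ⁾` (prior Thm. C) and
  hence the 10 MIXED-VOLUME identities (coefficients of `tᵢ tⱼ`, `i < j`, of the quadratic matrix
  identity `classOf 𝒵 = ⋀² B_t · Mq`), invisible in the pointwise formulation; (iii) differentiation in
  `t` on the fixed finite graph gives the flow / obstruction space `D(Z) = O(Z)^⊥` (prior Thm. D(ii),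
  `W(Z) = ℝ e₆` criterion) as plain linear algebra; (iv) induction on `𝒵.size` via antimonotonicity of
  the deformation space. None of (i)–(iv) is available on the `∀ t ∃ Z_t` side of K1.
* `stub_rung_sixthDirection` (L, plan-only RUNG, NOT consumed by the assembly): the same core statement
  for formal chains over the SIX-parameter family `F₊ = F_KS ⊕ ℚ B₆` (`B₆ = B₁ R₂R₃R₄R₅`) is true and
  provable by finite linear algebra: formal cycle classes over `F₊` lie in `Hdg₂(F₊) = ℚ • 1`
  (prior programme: `dim Hdg_p(F₊) = 1,1,1,10`; "fully flexible ⟹ Lefschetz"). It is the first rung of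
  this line's ladder; the ceiling is exactly the fifth-versus-sixth direction (`Hdg₂(F_KS) = 6`).

Assembly `EffectiveCayleyNonRealizability_of` (sorry-free logic): realisability on `U` ⟶ (stub 1) a
rational formal chain on `V ⊆ U` ⟶ (stub 2) a formal cycle with rational class `Mq`, `M = Mq` ⟶
(stub 3) `Mq = r • 1` ⟶ `M = r • 1`.

Disproof used: none exists for this crux (`ledger crux ls`: no `Disproof.lean`). Refuter birth note
honoured: `IsOpen`/`Nonempty` and `Effective` are load-bearing in stubs 1 and 3 (pointwise K1 is false
at `t = e₀`; signed cycles realise everything on rational tori, Amini–Piquerez Thm. 1.1).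
Dead lines avoided: "automatic sixth flexibility" (every F_KS-formal cycle is F₊-formal) is REFUTED by
the prior programme (exactly-F_KS-rigid theta complexes) — stub 3 is a CLASS-level statement and the
rung is not claimed to cover it; symmetry-forced constructions are theta (prior Thm. nogo) — not used.

Sources: Zharkov2020TropicalWeil (pp. 2–3: framed chains, formal cycles, eqs. (1),(2)),
MikhalkinZharkov2014Eigenwave (Def. 4.2, Prop. 4.3, Thm. 5.4), AminiPiquerez2020TropicalHC (Thm. 1.1,
Conj. 1.2), vanGeemenVerra2003QuaternionicPryms (§6), prior programme archive
`hodge-neg/tropical-kuga-satake` (paper-v2: Thm. C formal cycles, Thm. D deformation criterion,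
Thm. E fully-flexible ⟹ Lefschetz, §5 `F₊`, Lemma span).
-/

namespace Summit.HodgeConjecture.HodgeConjecture.Cruxes.EffectiveCayleyNonRealizability.FormalRational

open Literature.AlgebraicGeometry.Tropical Literature.AlgebraicGeometry.Tropical.TropicalTorus
open Summit.HodgeConjecture.HodgeConjecture.Theses.TropicalKugaSatakeCayley

noncomputable section

/-! ## Formal (polynomial-coordinate) chains of the Kuga–Satake family: two one-line devices -/

/-- The GENERIC period matrix of the family as a matrix of linear forms:
`B_t = Σ_i t_i • ksForm i` with `t_i` the variables of `ℚ[t₀,…,t₄]`. [folklore] -/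
def ksMatrixPoly : Matrix (Fin 8) (Fin 8) (MvPolynomial (Fin 5) ℚ) :=
  ∑ i : Fin 5, (MvPolynomial.X i : MvPolynomial (Fin 5) ℚ) • (ksForm i).map (Int.cast : ℤ → MvPolynomial (Fin 5) ℚ)

/-- Evaluation of a formal cell at a real parameter `t ∈ ℝ⁵` (coordinates through `aeval t`; the
rational frame and weight are kept). [folklore] -/
def evalCell (t : Fin 5 → ℝ) (c : Cell (MvPolynomial (Fin 5) ℚ) 8 2) : Cell ℝ 8 2 where
  base := fun r => MvPolynomial.aeval t (c.base r)
  dir := c.dir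
  coef := fun i j => MvPolynomial.aeval t (c.coef i j)
  weight := c.weight

/-- Evaluation of a formal chain at a real parameter `t ∈ ℝ⁵` (cellwise). [folklore] -/
def evalChain (t : Fin 5 → ℝ) (Z : Chain (MvPolynomial (Fin 5) ℚ) 8 2) : Chain ℝ 8 2 :=
  ⟨Z.size, fun c => evalCell t (Z.cell c)⟩

/-! ## The stubs -/

/-- **Stub 1 — RATIONAL FORMALISATION (size L).** If the period class `M` is realised by effective
tropical `2`-cycles of `ℝ⁸ / B_t ℤ⁸` at every `t` of a non-empty open `U ⊆ ksPosCone`, then some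
AFFINE-LINEAR formal chain over `ℚ[t₁,…,t₅]` evaluates, at every `t` of a non-empty open `V ⊆ U`, to an
effective tropical cycle of `ℝ⁸ / B_t ℤ⁸` with period class `M` (Baire for a `ℚ`-generic `t* ∈ U`;
rational linear incidence system; rational affine section `ε`-close to `Z_{t*}`; coarsened incidences
keep `IsCycle`; effectivity open; class locally constant along the section).
[cite: Zharkov2020TropicalWeil, p. 3] [cite: MikhalkinZharkov2014Eigenwave, Prop. 4.3] -/
theorem stub_rationalFormalization :
    ∀ U : Set (Fin 5 → ℝ), IsOpen U → U.Nonempty → U ⊆ ksPosCone →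
      ∀ M : Matrix (Sub 8 2) (Sub 8 2) ℝ,
        (∀ t ∈ U, ∃ Z : Chain ℝ 8 2, Z.IsCycle (ksMatrix t) ∧ Z.Effective ∧
          compound 2 (ksMatrix t)⁻¹ * Z.classOf = M) →
        ∃ 𝒵 : Chain (MvPolynomial (Fin 5) ℚ) 8 2, 𝒵.IsAffineLinear ∧
          ∃ V : Set (Fin 5 → ℝ), IsOpen V ∧ V.Nonempty ∧ V ⊆ U ∧
            ∀ t ∈ V, (evalChain t 𝒵).IsCycle (ksMatrix t) ∧ (evalChain t 𝒵).Effective ∧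
              compound 2 (ksMatrix t)⁻¹ * (evalChain t 𝒵).classOf = M := by
  sorry

/-- **Stub 2 — IDENTITY PRINCIPLE (size M).** For an affine-linear formal chain which, at every `t` of a
non-empty open `V ⊆ ksPosCone`, evaluates to a tropical cycle of `ℝ⁸ / B_t ℤ⁸` with period class `M`:
(a) it is a cycle FORMALLY — its framed boundary vanishes over the polynomial ring, modulo translations
by `ksMatrixPoly · ℤ⁸` (the incidence pattern at a generic `t` is the formal one); (b) `M` is rational
(read off at a rational `t ∈ V`); (c) `V` contains a rational parameter. [folklore]
[cite: Zharkov2020TropicalWeil, p. 3] -/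
theorem stub_identityPrinciple :
    ∀ 𝒵 : Chain (MvPolynomial (Fin 5) ℚ) 8 2, 𝒵.IsAffineLinear →
      ∀ V : Set (Fin 5 → ℝ), IsOpen V → V.Nonempty → V ⊆ ksPosCone →
        ∀ M : Matrix (Sub 8 2) (Sub 8 2) ℝ,
          (∀ t ∈ V, (evalChain t 𝒵).IsCycle (ksMatrix t) ∧
            compound 2 (ksMatrix t)⁻¹ * (evalChain t 𝒵).classOf = M) →
          𝒵.IsCycle ksMatrixPoly ∧
            (∃ Mq : Matrix (Sub 8 2) (Sub 8 2) ℚ, M = Mq.map (algebraMap ℚ ℝ)) ∧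
            ∃ q : Fin 5 → ℚ, (fun i => (q i : ℝ)) ∈ V := by
  sorry

/-- **Stub 3 — FORMAL CORE RIGIDITY (size XL; the transferred core C⁺).** An affine-linear formal chain
over `ℚ[t₁,…,t₅]` that is FORMALLY a cycle of the Kuga–Satake family (`IsCycle ksMatrixPoly`) and that
is effective with constant rational period class `Mq` at every `t` of a non-empty open subset of the cone
has `Mq ∈ ℚ • 1`: a rational formal cycle of the family carries no Cayley component. (Finite, `ℚ`-defined
object: bounded instances decidable; Minkowski structure `𝒵(t) = Σ tᵢ 𝒵⁽ⁱ⁾` and the mixed-volume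
identities; flows `D(Z) = O(Z)^⊥`; induction on `size`.) [cite: Zharkov2020TropicalWeil, pp. 2–3]
[cite: AminiPiquerez2020TropicalHC, Conj. 1.2] -/
theorem stub_formalCoreRigidity :
    ∀ 𝒵 : Chain (MvPolynomial (Fin 5) ℚ) 8 2, 𝒵.IsAffineLinear → 𝒵.IsCycle ksMatrixPoly →
      ∀ V : Set (Fin 5 → ℝ), IsOpen V → V.Nonempty → V ⊆ ksPosCone →
        ∀ Mq : Matrix (Sub 8 2) (Sub 8 2) ℚ,
          (∀ t ∈ V, (evalChain t 𝒵).Effective ∧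
            compound 2 (ksMatrix t)⁻¹ * (evalChain t 𝒵).classOf = Mq.map (algebraMap ℚ ℝ)) →
          ∃ r : ℚ, Mq = r • (1 : Matrix (Sub 8 2) (Sub 8 2) ℚ) := by
  sorry

/-- The sixth direction `B₆ = B₁ ω`, `ω = R₂ R₃ R₄ R₅` (integral; `F₊ = F_KS ⊕ ℚ B₆` is the family of all
`D`-compatible symmetric forms, prior programme §5). [folklore] -/
def ksSixth : Matrix (Fin 8) (Fin 8) ℤ :=
  ksBase * ksClifford 0 * ksClifford 1 * ksClifford 2 * ksClifford 3

/-- The six-parameter period matrix `Σ_{i<5} s_i ksForm i + s_5 B₆` at `s ∈ ℝ⁶`. [folklore] -/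
def ksMatrixPlus (s : Fin 6 → ℝ) : Matrix (Fin 8) (Fin 8) ℝ :=
  (∑ i : Fin 5, s (Fin.castSucc i) • (ksForm i).map (Int.cast : ℤ → ℝ)) +
    s (Fin.last 5) • ksSixth.map (Int.cast : ℤ → ℝ)

/-- The same as a matrix of linear forms in `ℚ[s₀,…,s₅]`. [folklore] -/
def ksMatrixPlusPoly : Matrix (Fin 8) (Fin 8) (MvPolynomial (Fin 6) ℚ) :=
  (∑ i : Fin 5, (MvPolynomial.X (Fin.castSucc i) : MvPolynomial (Fin 6) ℚ) •
      (ksForm i).map (Int.cast : ℤ → MvPolynomial (Fin 6) ℚ)) +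
    (MvPolynomial.X (Fin.last 5) : MvPolynomial (Fin 6) ℚ) • ksSixth.map (Int.cast : ℤ → MvPolynomial (Fin 6) ℚ)

/-- Evaluation of a six-parameter formal cell at `s ∈ ℝ⁶`. [folklore] -/
def evalCell₆ (s : Fin 6 → ℝ) (c : Cell (MvPolynomial (Fin 6) ℚ) 8 2) : Cell ℝ 8 2 where
  base := fun r => MvPolynomial.aeval s (c.base r)
  dir := c.dir
  coef := fun i j => MvPolynomial.aeval s (c.coef i j)
  weight := c.weight

/-- Evaluation of a six-parameter formal chain at `s ∈ ℝ⁶`. [folklore] -/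
def evalChain₆ (s : Fin 6 → ℝ) (Z : Chain (MvPolynomial (Fin 6) ℚ) 8 2) : Chain ℝ 8 2 :=
  ⟨Z.size, fun c => evalCell₆ s (Z.cell c)⟩

/-- **Stub 4 — RUNG: the sixth direction (size L; plan-only rung, NOT consumed by the assembly).** The
core statement one parameter up is a theorem of linear algebra: an affine-linear formal chain over
`ℚ[s₀,…,s₅]` that is formally a cycle of the SIX-parameter family `F₊ = F_KS ⊕ ℚ B₆` and is effective
with constant period class `Mq` on a non-empty open set of positive-definite parameters has
`Mq ∈ ℚ • 1` — formal cycle classes over `F₊` lie in the generic Hodge classes of `F₊`, which are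
`ℚ • 1` (`dim Hdg₂(F₊) = 1`, exact computation; "fully flexible ⟹ Lefschetz"). Technique: eigenwave
kills cycle classes at each `s` (MZ Thm. 5.4 for the chain encoding) + six `ℚ`-independent directions +
the explicit kernel computation. [cite: MikhalkinZharkov2014Eigenwave, Thm. 5.4]
[cite: Zharkov2020TropicalWeil, p. 2] -/
theorem stub_rung_sixthDirection :
    ∀ 𝒵 : Chain (MvPolynomial (Fin 6) ℚ) 8 2, 𝒵.IsAffineLinear → 𝒵.IsCycle ksMatrixPlusPoly →
      ∀ V : Set (Fin 6 → ℝ), IsOpen V → V.Nonempty → (∀ s ∈ V, (ksMatrixPlus s).PosDef) →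
        ∀ Mq : Matrix (Sub 8 2) (Sub 8 2) ℚ,
          (∀ s ∈ V, (evalChain₆ s 𝒵).Effective ∧
            compound 2 (ksMatrixPlus s)⁻¹ * (evalChain₆ s 𝒵).classOf = Mq.map (algebraMap ℚ ℝ)) →
          ∃ r : ℚ, Mq = r • (1 : Matrix (Sub 8 2) (Sub 8 2) ℚ) := by
  sorry

/-! ## Name-keyed aliases of the three load-bearing statements (hypotheses of the skeleton theorem) -/
namespace __Registered

/-- Statement of `stub_rationalFormalization`, keyed by the registered stub name. -/
abbrev stub_rationalFormalization : Prop :=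
  ∀ U : Set (Fin 5 → ℝ), IsOpen U → U.Nonempty → U ⊆ ksPosCone →
    ∀ M : Matrix (Sub 8 2) (Sub 8 2) ℝ,
      (∀ t ∈ U, ∃ Z : Chain ℝ 8 2, Z.IsCycle (ksMatrix t) ∧ Z.Effective ∧
        compound 2 (ksMatrix t)⁻¹ * Z.classOf = M) →
      ∃ 𝒵 : Chain (MvPolynomial (Fin 5) ℚ) 8 2, 𝒵.IsAffineLinear ∧
        ∃ V : Set (Fin 5 → ℝ), IsOpen V ∧ V.Nonempty ∧ V ⊆ U ∧
          ∀ t ∈ V, (evalChain t 𝒵).IsCycle (ksMatrix t) ∧ (evalChain t 𝒵).Effective ∧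
            compound 2 (ksMatrix t)⁻¹ * (evalChain t 𝒵).classOf = M

/-- Statement of `stub_identityPrinciple`, keyed by the registered stub name. -/
abbrev stub_identityPrinciple : Prop :=
  ∀ 𝒵 : Chain (MvPolynomial (Fin 5) ℚ) 8 2, 𝒵.IsAffineLinear →
    ∀ V : Set (Fin 5 → ℝ), IsOpen V → V.Nonempty → V ⊆ ksPosCone →
      ∀ M : Matrix (Sub 8 2) (Sub 8 2) ℝ,
        (∀ t ∈ V, (evalChain t 𝒵).IsCycle (ksMatrix t) ∧
          compound 2 (ksMatrix t)⁻¹ * (evalChain t 𝒵).classOf = M) →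
        𝒵.IsCycle ksMatrixPoly ∧
          (∃ Mq : Matrix (Sub 8 2) (Sub 8 2) ℚ, M = Mq.map (algebraMap ℚ ℝ)) ∧
          ∃ q : Fin 5 → ℚ, (fun i => (q i : ℝ)) ∈ V

/-- Statement of `stub_formalCoreRigidity`, keyed by the registered stub name. -/
abbrev stub_formalCoreRigidity : Prop :=
  ∀ 𝒵 : Chain (MvPolynomial (Fin 5) ℚ) 8 2, 𝒵.IsAffineLinear → 𝒵.IsCycle ksMatrixPoly →
    ∀ V : Set (Fin 5 → ℝ), IsOpen V → V.Nonempty → V ⊆ ksPosCone →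
      ∀ Mq : Matrix (Sub 8 2) (Sub 8 2) ℚ,
        (∀ t ∈ V, (evalChain t 𝒵).Effective ∧
          compound 2 (ksMatrix t)⁻¹ * (evalChain t 𝒵).classOf = Mq.map (algebraMap ℚ ℝ)) →
        ∃ r : ℚ, Mq = r • (1 : Matrix (Sub 8 2) (Sub 8 2) ℚ)

end __Registered

/-- Casting the rational theta multiple `r • 1` to real matrices gives `(r : ℝ) • 1`. [folklore] -/
theorem map_rat_smul_one (r : ℚ) :
    (r • (1 : Matrix (Sub 8 2) (Sub 8 2) ℚ)).map (algebraMap ℚ ℝ) =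
      (r : ℝ) • (1 : Matrix (Sub 8 2) (Sub 8 2) ℝ) := by
  ext i j
  by_cases h : i = j
  · subst h; simp
  · simp [Matrix.one_apply_ne h]

/-- **Composition (real proof) — THE SKELETON THEOREM.** Realisability of `M` on `U` ⟶ (stub 1) an
affine-linear rational formal chain realising `M` effectively on an open `V ⊆ U` ⟶ (stub 2) it is a
formal cycle and `M = Mq` is rational ⟶ (stub 3) `Mq = r • 1` ⟶ `M = r • 1`. Hypotheses = the three
load-bearing stub statements (name-keyed aliases); concludes the route decl
`EffectiveCayleyNonRealizability` BY NAME. -/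
theorem EffectiveCayleyNonRealizability_of :
    __Registered.stub_rationalFormalization → __Registered.stub_identityPrinciple →
      __Registered.stub_formalCoreRigidity → EffectiveCayleyNonRealizability := by
  intro h₁ h₂ h₃ U hU hne hsub M hM
  obtain ⟨𝒵, hlin, V, hVo, hVne, hVU, hV⟩ := h₁ U hU hne hsub M hM
  have hVcone : V ⊆ ksPosCone := hVU.trans hsub
  obtain ⟨hcyc, ⟨Mq, hMq⟩, -⟩ :=
    h₂ 𝒵 hlin V hVo hVne hVcone M (fun t ht => ⟨(hV t ht).1, (hV t ht).2.2⟩)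
  obtain ⟨r, hr⟩ := h₃ 𝒵 hlin hcyc V hVo hVne hVcone Mq
    (fun t ht => ⟨(hV t ht).2.1, hMq ▸ (hV t ht).2.2⟩)
  exact ⟨(r : ℝ), by rw [hMq, hr, map_rat_smul_one]⟩

/-- **The crux, closed modulo exactly the three load-bearing stubs** (sanity: each alias IS its stub's
statement, by definitional unfolding). -/
theorem EffectiveCayleyNonRealizability_of_stubs : EffectiveCayleyNonRealizability :=
  EffectiveCayleyNonRealizability_of stub_rationalFormalization stub_identityPrinciple
    stub_formalCoreRigidity

end

end Summit.HodgeConjecture.HodgeConjecture.Cruxes.EffectiveCayleyNonRealizability.FormalRational
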